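/-
Copyright (c) 2026 the pub-hodgecm-mathlib formalisation cell (harness21).  Prover seat hodgecm-mathlib-F0P3a-p01 (g17): road «S3-ram» (LEAD F0P3a-plan; architect A-p16;
owner F0P3a-p06), the (a2) JUNCTION (J★) of crux H413 — J-PACK v2 assembly pen; 2026-09-02.
-/
import Literature.NumberTheory.Automorphic.UnitaryLatticeTreeFixedGrandchildrenSliceCountRamified   -- ★ G3⁺ (F0P2-p06): GC currency, root, tokens
import Literature.NumberTheory.Automorphic.UnitaryLatticeTreeTypeTwoParent                     -- ★ `scaleLattice_one`
import Literature.NumberTheory.Automorphic.UnitaryLatticeTreeFixedVertex                        -- ★ `scaleLattice_scaleLattice`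
import Literature.NumberTheory.Automorphic.UnitaryLatticeTreeFramesOfInvolution                  -- ★ `isTree_latticeGraph_three_of_neg`
import Literature.NumberTheory.Automorphic.UnitaryLatticeTreeFixedGrandchildFrameRamified          -- ★ FILE L (F0P2-p01)
import Literature.NumberTheory.Automorphic.UnitaryLatticeTreeTypeTwoGram                          -- ★ `isIntMatrix_mul`
import Literature.NumberTheory.Automorphic.UnitaryLatticeTreeNilpotencyTokenOfDepths               -- ★ ROW-N (F0P3-p03)
import Literature.NumberTheory.Automorphic.UnitaryLatticeTreeRankOneVertexOneClassRamified         -- ★ ROW-1C (F0P3a-p05)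
import Literature.NumberTheory.Automorphic.UnitaryLatticeTreeClassConstantDictionaryRamified        -- ★ 1C-TRANS + SGN-DICT (F0P3a-p05)
import Literature.NumberTheory.Automorphic.UnitaryLatticeTreeRootGrandchildLabelsRamified          -- ★ ROW-ROOT-LBL (F0P3a-p04)
import Literature.NumberTheory.Automorphic.UnitaryLatticeTreeRegionUpClosedRamified                 -- ★ S1 + row-free orientation (F0P3-p04)
import Literature.NumberTheory.Rogawski1990.DepthZeroKappaTransferTypeOneRamifiedTreeInduction      -- ★ ENGINE (F0P3a-p01 (g16)); brings ★ G1 `exists_rooted_parent`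
import Literature.NumberTheory.Automorphic.UnitaryLatticeTreeFixedChildrenShallowerRamified        -- ★ `lev_mono_of_le` (F0P2-p01)
import Literature.NumberTheory.Automorphic.UnitaryLatticeTreeEigenframeCharpoly                    -- ★ `charpoly_of_eigenframe` (A-p16)
import Literature.NumberTheory.Automorphic.UnitaryLatticeTreeOrientationOfRowsRamified             -- ★ L2 `dep_lt_and_exists_orientation` (F0P2-p01)
import Literature.NumberTheory.Automorphic.UnitaryLatticeTreeSliceCountKeyedRamified               -- ★ κ-keyed slices (F0P2-p06)
import Literature.NumberTheory.Automorphic.UnitaryLatticeTreeOffRegionGrandchildLabelsRamified      -- ★ S2 (F0P3a-p04)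
import Literature.NumberTheory.Rogawski1990.DepthZeroKappaTransferTypeOneRamifiedJunctionLabels   -- ★ JUNCTION I (this seat)
import HarnessLib

/-!
# The ramified type-(1) `κ`-orbital integral, JUNCTION II: the labels and counts of the root's fixed grandchildren (equilateral) and of the off-region grandchildren of a region vertex (isoceles)

Topic `NumberTheory/Rogawski1990`; namespace `Literature.NumberTheory.Rogawski1990.TypeOneRamifiedJunction`.  THEOREMS ONLY (no definition, no instance, no notation, no
named fact, no `sorry`); kernel lane `--supports stmt-HodgeConjecture-24833`.  Cell `pub/hodgecm-mathlib` (D-0151), crux H413; road «S3-ram» (count-neutral), P-1-ram organ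
A′ (ii) (a2): THE JUNCTION between the ★ local laws of the fixed labelled lattice tree of a ramified type-(1) literal (J-PACK v2 rows, landed by F0P2-p01 ∕ F0P2-p06 ∕ F0P3-p03 ∕
F0P3-p04 ∕ F0P3a-p04 ∕ F0P3a-p05 ∕ F0P2-p02 ∕ LH4) and the ★ tree-induction ENGINE (F0P3a-p01 (g16), ED. 3 F0P3a-p02): everything runs in the `J₀`-MODEL (root `r₀ = 𝒪³`,
`γ ∈ K₀` the literal normalised by its middle eigenvalue and conjugated by the ★ `GL₃(𝒪)` frame of the literal's diagonal form), with the CONCRETE LABELS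
`dep w = Nat.findGreatest (e ↦ (γ−1)w ⊆ ϖ^e w) B`, `rk w = if (γ−1)²w ⊆ ϖ^(2·dep w+1)·w then 1 else 2`, `cl w = if CLS[w](dep w, c₁) then 1 else −1` — characterised abstractly in
the statements (`hdep hrk hcl`) in the engine's own binder style so that every lemma is instantiated by `rfl`.

* `rootData_of_rows` (L4): the engine's `hrdep` and `hroot` at `r₀` — root token from the eigenframe, line values integral, labels by ★ `rootGrandchildLabels_equilateral`
  (F0P3a-p04), the three counts by the ★ κ-keyed slice `ncard_rootGrandchildren_sep_eq_mul_ncard_keyed` (F0P2-p06) and the class dictionary «`cl w = ±1` ⟺ line class `−c₁ ∕ −c₁ε`»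
  (★ ROW-1C, ★ `exists_unit_sub_mul_sq_lt_one_of_fixed_selfDual_rankOne`, F0P3a-p05).
* `regionData_of_rows` (iso-L4): at a region vertex (`LEV[v](ϖ^d₀)`) every fixed grandchild outside the region has the `E`- or `P`-label (★ `offRegionGrandchildLabels`, F0P3a-p04).
HONEST LABEL: HC_CM is proved only modulo the 2 remaining named inputs (hLiu418 24832, h413 24833) until rung 0 closes; nothing printed is asserted here (lattice
bookkeeping over ★ results); «S3-ram» is Literature seeding, count-neutral.

## References
* [Kottwitz1986] R. E. Kottwitz, *Base change for unit elements of Hecke algebras*, Compositio Math. 60 (1986), §3 (counting fixed lattices shell by shell).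
* [Rogawski1990] J. D. Rogawski, *Automorphic Representations of Unitary Groups in Three Variables*, Ann. of Math. Stud. 123 (1990), §4.9 pp. 54–56 (the strata of the
  ramified orbital integrals), Prop. 4.9.1.
* [LabesseLanglands1979] J.-P. Labesse, R. P. Langlands, *L-indistinguishability for SL(2)*, Canad. J. Math. 31 (1979), §2 (κ-signed counts over the four literals).
* [BruhatTits1972] F. Bruhat, J. Tits, *Groupes réductifs sur un corps local I*, Publ. Math. IHÉS 41 (1972), §10 (lattice models of the building).
* [Serre1980Trees] J.-P. Serre, *Trees* (1980), I.2.3, II.1.1.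
-/

set_option autoImplicit false

noncomputable section

open scoped Valued WithZero Matrix MatrixGroups
open Polynomial Classical SimpleGraph
open Literature.Combinatorics.SimpleGraph.TreeLayers
open Literature.NumberTheory.Automorphic Literature.NumberTheory.Automorphic.HermitianLattice Literature.NumberTheory.Automorphic.UnitaryLatticeTree

namespace Literature.NumberTheory.Rogawski1990.TypeOneRamifiedJunction

variable {K : Type*} [Field K] [Valued K ℤᵐ⁰] {σ : K →+* K} {ϖ : K}

/-- L4 (assembly pen): the engine's root data `hrdep`, `hroot` (labels of the root grandchildren + the three counts `q·νE, q·νP, q·νM`) from ROW-ROOT-LBL ∕ SLICE. [cite: Kottwitz1986, §3] [cite: Rogawski1990, §4.9 pp. 54–56] -/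
theorem rootData_of_rows (hσ : ∀ x, σ (σ x) = x) (hvσ : ∀ a, Valued.v (σ a) = Valued.v a) (hσϖ : σ ϖ = -ϖ)
    (hϖ : Valued.v ϖ = WithZero.exp (-1 : ℤ)) (hres : ∀ x : K, Valued.v x ≤ 1 → Valued.v (σ x - x) < 1) (h2 : Valued.v (2 : K) = 1) [Finite 𝓀[K]]
    (hT : (latticeGraph σ ϖ ((StdForm.antidiagonal 3).over K)).IsTree)
    {γ : unitaryGroupOfForm σ ((StdForm.antidiagonal 3).over K)} (hγ0 : γ ∈ unitaryInt σ ((StdForm.antidiagonal 3).over K))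
    (hnorm : ∀ u : K, σ u = u → Valued.v (u - 1) < 1 → ∃ z : K, z * σ z = u ∧ Valued.v (z - 1) ≤ Valued.v (u - 1))
    (d : Fin 3 → K) (hd : ∀ i, Valued.v (d i) = 1) (hdσ : ∀ i, σ (d i) = d i)
    (A : GL (Fin 3) K) (hA : IsIntMatrix (A : Matrix (Fin 3) (Fin 3) K)) (hA' : IsIntMatrix ((A⁻¹ : GL (Fin 3) K) : Matrix (Fin 3) (Fin 3) K))
    (hdA : Matrix.diagonal d = (-(Matrix.diagonal d).det) • formCongr σ A ((StdForm.antidiagonal 3).over K))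
    (s : Fin 3 → K) (hs1 : s 1 = 1) (hsv : ∀ i, Valued.v (s i) = 1) (hsσ : ∀ i, s i * σ (s i) = 1)
    (hγA : ((γ : GL (Fin 3) K) : Matrix (Fin 3) (Fin 3) K) = (A : Matrix (Fin 3) (Fin 3) K) * Matrix.diagonal s * ((A⁻¹ : GL (Fin 3) K) : Matrix (Fin 3) (Fin 3) K))
    {N : ℕ} (hN3 : 3 ≤ N) (hs0 : Valued.v (s 0 - 1) = Valued.v ϖ ^ N) (hs2 : Valued.v (s 2 - 1) = Valued.v ϖ ^ N) (hs02 : Valued.v (s 0 - s 2) = Valued.v ϖ ^ N)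
    (c₁ ε : K) (hc₁ : Valued.v c₁ = 1) (hεv : Valued.v ε = 1) (hε : ∀ z : K, Valued.v z ≤ 1 → Valued.v (z ^ 2 - ε) = 1)
    (B : ℕ) (dep rk : {M : Submodule 𝒪[K] (Fin 3 → K) // IsVertex σ ϖ ((StdForm.antidiagonal 3).over K) M} → ℕ) (cl : {M : Submodule 𝒪[K] (Fin 3 → K) // IsVertex σ ϖ ((StdForm.antidiagonal 3).over K) M} → ℤ)
    (hdep : ∀ w : {M : Submodule 𝒪[K] (Fin 3 → K) // IsVertex σ ϖ ((StdForm.antidiagonal 3).over K) M}, latticeGraphIso σ ϖ ((StdForm.antidiagonal 3).over K) γ w = w → ∀ e, e ≤ dep w ↔ e ≤ B ∧ w.1.map ((Matrix.toLin' (((γ : GL (Fin 3) K) : Matrix (Fin 3) (Fin 3) K) - 1)).restrictScalars 𝒪[K]) ≤ scaleLattice (ϖ ^ e) w.1)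
    (hrk : ∀ w : {M : Submodule 𝒪[K] (Fin 3 → K) // IsVertex σ ϖ ((StdForm.antidiagonal 3).over K) M}, rk w = if w.1.map ((Matrix.toLin' ((((γ : GL (Fin 3) K) : Matrix (Fin 3) (Fin 3) K) - 1) ^ 2)).restrictScalars 𝒪[K]) ≤ scaleLattice (ϖ ^ (2 * dep w + 1)) w.1 then 1 else 2)
    (hcl : ∀ w : {M : Submodule 𝒪[K] (Fin 3 → K) // IsVertex σ ϖ ((StdForm.antidiagonal 3).over K) M}, cl w = if (∃ y ∈ w.1, ∃ a : K, Valued.v a = 1 ∧ Valued.v ((ϖ ^ (dep w))⁻¹ * pairing σ ((StdForm.antidiagonal 3).over K) y ((((γ : GL (Fin 3) K) : Matrix (Fin 3) (Fin 3) K) - 1) *ᵥ y) - (c₁) * a ^ 2) < 1) then (1 : ℤ) else -1)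
    (hBN : B = N)
    (GC : {M : Submodule 𝒪[K] (Fin 3 → K) // IsVertex σ ϖ ((StdForm.antidiagonal 3).over K) M} → Set {M : Submodule 𝒪[K] (Fin 3 → K) // IsVertex σ ϖ ((StdForm.antidiagonal 3).over K) M}) (hGC : ∀ v w, w ∈ GC v ↔ ∃ c, ((latticeGraph σ ϖ ((StdForm.antidiagonal 3).over K)).Adj v c ∧ (latticeGraph σ ϖ ((StdForm.antidiagonal 3).over K)).dist ⟨stdLattice K 3, 0, isSelfDualLattice_stdLattice_three_of_v hϖ⟩ c = (latticeGraph σ ϖ ((StdForm.antidiagonal 3).over K)).dist ⟨stdLattice K 3, 0, isSelfDualLattice_stdLattice_three_of_v hϖ⟩ v + 1 ∧ c ∈ {v | latticeGraphIso σ ϖ ((StdForm.antidiagonal 3).over K) γ v = v}) ∧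
      ((latticeGraph σ ϖ ((StdForm.antidiagonal 3).over K)).Adj c w ∧ (latticeGraph σ ϖ ((StdForm.antidiagonal 3).over K)).dist ⟨stdLattice K 3, 0, isSelfDualLattice_stdLattice_three_of_v hϖ⟩ w = (latticeGraph σ ϖ ((StdForm.antidiagonal 3).over K)).dist ⟨stdLattice K 3, 0, isSelfDualLattice_stdLattice_three_of_v hϖ⟩ c + 1 ∧ w ∈ {v | latticeGraphIso σ ϖ ((StdForm.antidiagonal 3).over K) γ v = v}))
    (q : ℕ) (hq : q = Nat.card 𝓀[K]) (k : ℕ) (hNk : N = 2 * k + 3)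
    (νE νP νM : ℕ)
    (hνE : ({c : {M : Submodule 𝒪[K] (Fin 3 → K) // IsVertex σ ϖ ((StdForm.antidiagonal 3).over K) M} | (latticeGraph σ ϖ ((StdForm.antidiagonal 3).over K)).Adj ⟨stdLattice K 3, 0, isSelfDualLattice_stdLattice_three_of_v hϖ⟩ c ∧ ∃ κ : unitaryGroupOfForm σ ((StdForm.antidiagonal 3).over K), κ ∈ unitaryInt σ ((StdForm.antidiagonal 3).over K) ∧ c = latticeGraphIso σ ϖ ((StdForm.antidiagonal 3).over K) κ ⟨latt (Matrix.diagonal ![(1 : K), 1, ϖ]), 2, isVertexLattice_two_N₁_of_neg hσϖ hϖ⟩ ∧ (Valued.v ((ϖ ^ N)⁻¹ * pairing σ ((StdForm.antidiagonal 3).over K) (((κ : GL (Fin 3) K) : Matrix (Fin 3) (Fin 3) K) *ᵥ Pi.single 0 1) ((((γ : GL (Fin 3) K) : Matrix (Fin 3) (Fin 3) K) - 1) *ᵥ (((κ : GL (Fin 3) K) : Matrix (Fin 3) (Fin 3) K) *ᵥ Pi.single 0 1))) < 1)}).ncard = νE)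
    (hνP : ({c : {M : Submodule 𝒪[K] (Fin 3 → K) // IsVertex σ ϖ ((StdForm.antidiagonal 3).over K) M} | (latticeGraph σ ϖ ((StdForm.antidiagonal 3).over K)).Adj ⟨stdLattice K 3, 0, isSelfDualLattice_stdLattice_three_of_v hϖ⟩ c ∧ ∃ κ : unitaryGroupOfForm σ ((StdForm.antidiagonal 3).over K), κ ∈ unitaryInt σ ((StdForm.antidiagonal 3).over K) ∧ c = latticeGraphIso σ ϖ ((StdForm.antidiagonal 3).over K) κ ⟨latt (Matrix.diagonal ![(1 : K), 1, ϖ]), 2, isVertexLattice_two_N₁_of_neg hσϖ hϖ⟩ ∧ (∃ a : K, Valued.v a = 1 ∧ Valued.v (((ϖ ^ N)⁻¹ * pairing σ ((StdForm.antidiagonal 3).over K) (((κ : GL (Fin 3) K) : Matrix (Fin 3) (Fin 3) K) *ᵥ Pi.single 0 1) ((((γ : GL (Fin 3) K) : Matrix (Fin 3) (Fin 3) K) - 1) *ᵥ (((κ : GL (Fin 3) K) : Matrix (Fin 3) (Fin 3) K) *ᵥ Pi.single 0 1))) - (-c₁) * a ^ 2) < 1)}).ncard = νP)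
    (hνM : ({c : {M : Submodule 𝒪[K] (Fin 3 → K) // IsVertex σ ϖ ((StdForm.antidiagonal 3).over K) M} | (latticeGraph σ ϖ ((StdForm.antidiagonal 3).over K)).Adj ⟨stdLattice K 3, 0, isSelfDualLattice_stdLattice_three_of_v hϖ⟩ c ∧ ∃ κ : unitaryGroupOfForm σ ((StdForm.antidiagonal 3).over K), κ ∈ unitaryInt σ ((StdForm.antidiagonal 3).over K) ∧ c = latticeGraphIso σ ϖ ((StdForm.antidiagonal 3).over K) κ ⟨latt (Matrix.diagonal ![(1 : K), 1, ϖ]), 2, isVertexLattice_two_N₁_of_neg hσϖ hϖ⟩ ∧ (∃ a : K, Valued.v a = 1 ∧ Valued.v (((ϖ ^ N)⁻¹ * pairing σ ((StdForm.antidiagonal 3).over K) (((κ : GL (Fin 3) K) : Matrix (Fin 3) (Fin 3) K) *ᵥ Pi.single 0 1) ((((γ : GL (Fin 3) K) : Matrix (Fin 3) (Fin 3) K) - 1) *ᵥ (((κ : GL (Fin 3) K) : Matrix (Fin 3) (Fin 3) K) *ᵥ Pi.single 0 1))) - (-(c₁ * ε)) * a ^ 2) < 1)}).ncard = νM) :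
    2 ≤ dep ⟨stdLattice K 3, 0, isSelfDualLattice_stdLattice_three_of_v hϖ⟩ ∧
    ((∀ w ∈ GC ⟨stdLattice K 3, 0, isSelfDualLattice_stdLattice_three_of_v hϖ⟩, (dep w = 2 * k + 2 ∧ rk w = 2) ∨ (dep w = 2 * k + 1 ∧ rk w = 1 ∧ (cl w = 1 ∨ cl w = -1))) ∧
      {w | w ∈ GC ⟨stdLattice K 3, 0, isSelfDualLattice_stdLattice_three_of_v hϖ⟩ ∧ dep w = 2 * k + 2}.ncard = q * νE ∧ {w | w ∈ GC ⟨stdLattice K 3, 0, isSelfDualLattice_stdLattice_three_of_v hϖ⟩ ∧ dep w = 2 * k + 1 ∧ cl w = 1}.ncard = q * νP ∧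
        {w | w ∈ GC ⟨stdLattice K 3, 0, isSelfDualLattice_stdLattice_three_of_v hϖ⟩ ∧ dep w = 2 * k + 1 ∧ cl w = -1}.ncard = q * νM) := by
  rw [hBN] at hdep
  have hϖ0 : ϖ ≠ 0 := fun h0 => by rw [h0, map_zero] at hϖ; exact WithZero.coe_ne_zero hϖ.symm
  have hϖ1 : Valued.v ϖ ≤ 1 := by rw [hϖ, ← WithZero.exp_zero]; exact WithZero.exp_le_exp.2 (by norm_num)
  have hrfix : latticeGraphIso σ ϖ ((StdForm.antidiagonal 3).over K) γ ⟨stdLattice K 3, 0, isSelfDualLattice_stdLattice_three_of_v hϖ⟩ = ⟨stdLattice K 3, 0, isSelfDualLattice_stdLattice_three_of_v hϖ⟩ := latticeGraphIso_root_eq_of_mem_unitaryInt hϖ hγ0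
  have hrS : IsSelfDualLattice σ ϖ ((StdForm.antidiagonal 3).over K) (⟨stdLattice K 3, 0, isSelfDualLattice_stdLattice_three_of_v hϖ⟩ : {M : Submodule 𝒪[K] (Fin 3 → K) // IsVertex σ ϖ ((StdForm.antidiagonal 3).over K) M}).1 := isSelfDualLattice_stdLattice_three_of_v hϖ
  -- (A) the entries of `γ − 1` and the root token `LEV[r₀](ϖ^N)`
  have hAA : (A : Matrix (Fin 3) (Fin 3) K) * ((A⁻¹ : GL (Fin 3) K) : Matrix (Fin 3) (Fin 3) K) = 1 := by rw [← Units.val_mul, mul_inv_cancel, Units.val_one]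
  have hsub : ((γ : GL (Fin 3) K) : Matrix (Fin 3) (Fin 3) K) - 1 = (A : Matrix (Fin 3) (Fin 3) K) * Matrix.diagonal (fun i => s i - 1) * ((A⁻¹ : GL (Fin 3) K) : Matrix (Fin 3) (Fin 3) K) := by
    have hdg : Matrix.diagonal (fun i => s i - 1) = Matrix.diagonal s - 1 := by
      rw [← Matrix.diagonal_one, Matrix.diagonal_sub]
    rw [hγA, hdg, Matrix.mul_sub, Matrix.sub_mul, Matrix.mul_one, hAA]
  have hdiagb : ∀ i j, Valued.v (Matrix.diagonal (fun i => s i - 1) i j) ≤ Valued.v ϖ ^ N := by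
    intro i j
    by_cases hij : i = j
    · subst hij
      rw [Matrix.diagonal_apply_eq]
      fin_cases i
      · exact hs0.le
      · simp [hs1]
      · exact hs2.le
    · rw [Matrix.diagonal_apply_ne _ hij, map_zero]; exact zero_le
  have hentry : ∀ i j, Valued.v ((((γ : GL (Fin 3) K) : Matrix (Fin 3) (Fin 3) K) - 1) i j) ≤ Valued.v ϖ ^ N := by
    intro i j; rw [hsub]; exact v_mul_mul_apply_le_of_le hA hdiagb hA' i j
  have hdeep : ∀ i j, Valued.v ((((γ : GL (Fin 3) K) : Matrix (Fin 3) (Fin 3) K) - 1) i j) ≤ Valued.v ϖ ^ 2 :=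
    fun i j => (hentry i j).trans (pow_le_pow_right_of_le_one' hϖ1 (by omega))
  have hlevN : (⟨stdLattice K 3, 0, isSelfDualLattice_stdLattice_three_of_v hϖ⟩ : {M : Submodule 𝒪[K] (Fin 3 → K) // IsVertex σ ϖ ((StdForm.antidiagonal 3).over K) M}).1.map ((Matrix.toLin' (((γ : GL (Fin 3) K) : Matrix (Fin 3) (Fin 3) K) - 1)).restrictScalars 𝒪[K]) ≤ scaleLattice (ϖ ^ N) (⟨stdLattice K 3, 0, isSelfDualLattice_stdLattice_three_of_v hϖ⟩ : {M : Submodule 𝒪[K] (Fin 3 → K) // IsVertex σ ϖ ((StdForm.antidiagonal 3).over K) M}).1 := by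
    have h := (map_sub_one_latt_le_scaleLattice_iff (pow_ne_zero N hϖ0) (γ : GL (Fin 3) K) 1).2
      (by intro i j; rw [inv_one, one_mul, mul_one, map_pow]; exact hentry i j)
    rw [Units.val_one, latt_one] at h
    exact h
  have hrdep : 2 ≤ dep ⟨stdLattice K 3, 0, isSelfDualLattice_stdLattice_three_of_v hϖ⟩ := (hdep _ hrfix 2).2 ⟨by omega, lev_mono_of_le hϖ1 (by omega : 2 ≤ N) hlevN⟩
  -- depth bookkeeping through `hdep`
  have hdepeq : ∀ w : {M : Submodule 𝒪[K] (Fin 3 → K) // IsVertex σ ϖ ((StdForm.antidiagonal 3).over K) M}, latticeGraphIso σ ϖ ((StdForm.antidiagonal 3).over K) γ w = w → ∀ e, e < N → w.1.map ((Matrix.toLin' (((γ : GL (Fin 3) K) : Matrix (Fin 3) (Fin 3) K) - 1)).restrictScalars 𝒪[K]) ≤ scaleLattice (ϖ ^ e) w.1 → ¬ w.1.map ((Matrix.toLin' (((γ : GL (Fin 3) K) : Matrix (Fin 3) (Fin 3) K) - 1)).restrictScalars 𝒪[K]) ≤ scaleLattice (ϖ ^ (e + 1)) w.1 → dep w = e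 := by
    intro w hw e he h1 h2
    have a := (hdep w hw e).2 ⟨he.le, h1⟩
    have b : ¬ (e + 1 ≤ dep w) := fun h => h2 ((hdep w hw (e + 1)).1 h).2
    omega
  -- (B) the value of a root child line is integral
  have hVALint : ∀ κ : unitaryGroupOfForm σ ((StdForm.antidiagonal 3).over K), κ ∈ unitaryInt σ ((StdForm.antidiagonal 3).over K) → Valued.v ((ϖ ^ N)⁻¹ * pairing σ ((StdForm.antidiagonal 3).over K) (((κ : GL (Fin 3) K) : Matrix (Fin 3) (Fin 3) K) *ᵥ Pi.single 0 1) ((((γ : GL (Fin 3) K) : Matrix (Fin 3) (Fin 3) K) - 1) *ᵥ (((κ : GL (Fin 3) K) : Matrix (Fin 3) (Fin 3) K) *ᵥ Pi.single 0 1))) ≤ 1 := by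
    intro κ hκ
    rw [pairing_coe_mulVec_single_eq_inv_mul_mul_apply κ (((γ : GL (Fin 3) K) : Matrix (Fin 3) (Fin 3) K) - 1), coe_inv_mul_sub_one_mul_eq_conj_diagonal A (κ : GL (Fin 3) K) s hγA]
    have hP : IsIntMatrix (((A⁻¹ * (κ : GL (Fin 3) K) : GL (Fin 3) K)) : Matrix (Fin 3) (Fin 3) K) := by
      rw [Units.val_mul]; exact isIntMatrix_mul hA' (mem_unitaryInt_iff.1 hκ).1
    have hP' : IsIntMatrix ((((A⁻¹ * (κ : GL (Fin 3) K))⁻¹ : GL (Fin 3) K)) : Matrix (Fin 3) (Fin 3) K) := by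
      rw [mul_inv_rev, inv_inv, Units.val_mul]; exact isIntMatrix_mul (mem_unitaryInt_iff.1 hκ).2 hA
    have hcorner := v_mul_mul_apply_le_of_le hP' hdiagb hP (2 : Fin 3) 0
    rw [map_mul, map_inv₀, map_pow]
    calc (Valued.v ϖ ^ N)⁻¹ * _ ≤ (Valued.v ϖ ^ N)⁻¹ * Valued.v ϖ ^ N := mul_le_mul_right hcorner _
      _ = 1 := inv_mul_cancel₀ (pow_ne_zero _ (by rw [hϖ]; exact WithZero.coe_ne_zero))
  -- (C) labels of a far vertex `w` through the child `κ·N₁`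
  have hE : ∀ κ : unitaryGroupOfForm σ ((StdForm.antidiagonal 3).over K), κ ∈ unitaryInt σ ((StdForm.antidiagonal 3).over K) → ∀ w : {M : Submodule 𝒪[K] (Fin 3 → K) // IsVertex σ ϖ ((StdForm.antidiagonal 3).over K) M}, IsSelfDualLattice σ ϖ ((StdForm.antidiagonal 3).over K) w.1 → latticeGraphIso σ ϖ ((StdForm.antidiagonal 3).over K) γ w = w → w ≠ ⟨stdLattice K 3, 0, isSelfDualLattice_stdLattice_three_of_v hϖ⟩ →
      (latticeGraph σ ϖ ((StdForm.antidiagonal 3).over K)).Adj (latticeGraphIso σ ϖ ((StdForm.antidiagonal 3).over K) κ ⟨latt (Matrix.diagonal ![(1 : K), 1, ϖ]), 2, isVertexLattice_two_N₁_of_neg hσϖ hϖ⟩) w → Valued.v ((ϖ ^ N)⁻¹ * pairing σ ((StdForm.antidiagonal 3).over K) (((κ : GL (Fin 3) K) : Matrix (Fin 3) (Fin 3) K) *ᵥ Pi.single 0 1) ((((γ : GL (Fin 3) K) : Matrix (Fin 3) (Fin 3) K) - 1) *ᵥ (((κ : GL (Fin 3) K) : Matrix (Fin 3) (Fin 3)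 K) *ᵥ Pi.single 0 1))) < 1 → dep w = 2 * k + 2 ∧ rk w = 2 := by
    intro κ hκ w hw hfw hwr hadj ht
    obtain ⟨h1, h2, h3⟩ := (rootGrandchildLabels_equilateral hσ hvσ hσϖ hϖ hres h2 hnorm hT hγ0 d hd hdσ A hA hA' hdA s hs1 hsv hsσ hγA hN3 hs0 hs2 hs02 κ hκ hw hfw hwr hadj).1 ht
    have hd : dep w = 2 * k + 2 := hdepeq w hfw (2 * k + 2) (by omega) (by rw [show 2 * k + 2 = N - 1 by omega]; exact h1)
      (by rw [show 2 * k + 2 + 1 = N by omega]; exact h2)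
    refine ⟨hd, ?_⟩
    rw [hrk w, hd, show 2 * (2 * k + 2) + 1 = 2 * N - 1 by omega, if_neg h3]
  have hPP : ∀ κ : unitaryGroupOfForm σ ((StdForm.antidiagonal 3).over K), κ ∈ unitaryInt σ ((StdForm.antidiagonal 3).over K) → ∀ w : {M : Submodule 𝒪[K] (Fin 3 → K) // IsVertex σ ϖ ((StdForm.antidiagonal 3).over K) M}, IsSelfDualLattice σ ϖ ((StdForm.antidiagonal 3).over K) w.1 → latticeGraphIso σ ϖ ((StdForm.antidiagonal 3).over K) γ w = w → w ≠ ⟨stdLattice K 3, 0, isSelfDualLattice_stdLattice_three_of_v hϖ⟩ →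
      (latticeGraph σ ϖ ((StdForm.antidiagonal 3).over K)).Adj (latticeGraphIso σ ϖ ((StdForm.antidiagonal 3).over K) κ ⟨latt (Matrix.diagonal ![(1 : K), 1, ϖ]), 2, isVertexLattice_two_N₁_of_neg hσϖ hϖ⟩) w → Valued.v ((ϖ ^ N)⁻¹ * pairing σ ((StdForm.antidiagonal 3).over K) (((κ : GL (Fin 3) K) : Matrix (Fin 3) (Fin 3) K) *ᵥ Pi.single 0 1) ((((γ : GL (Fin 3) K) : Matrix (Fin 3) (Fin 3) K) - 1) *ᵥ (((κ : GL (Fin 3) K) : Matrix (Fin 3) (Fin 3) K) *ᵥ Pi.single 0 1))) = 1 →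
      dep w = 2 * k + 1 ∧ rk w = 1 ∧ (∃ y ∈ w.1, ∃ a : K, Valued.v a = 1 ∧ Valued.v ((ϖ ^ (2 * k + 1))⁻¹ * pairing σ ((StdForm.antidiagonal 3).over K) y ((((γ : GL (Fin 3) K) : Matrix (Fin 3) (Fin 3) K) - 1) *ᵥ y) - (-((ϖ ^ N)⁻¹ * pairing σ ((StdForm.antidiagonal 3).over K) (((κ : GL (Fin 3) K) : Matrix (Fin 3) (Fin 3) K) *ᵥ Pi.single 0 1) ((((γ : GL (Fin 3) K) : Matrix (Fin 3) (Fin 3) K) - 1) *ᵥ (((κ : GL (Fin 3) K) : Matrix (Fin 3) (Fin 3) K) *ᵥ Pi.single 0 1)))) * a ^ 2) < 1) ∧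
        w.1.map ((Matrix.toLin' (((γ : GL (Fin 3) K) : Matrix (Fin 3) (Fin 3) K) - 1)).restrictScalars 𝒪[K]) ≤ scaleLattice (ϖ ^ (2 * k + 1)) w.1 ∧ ¬ w.1.map ((Matrix.toLin' (((γ : GL (Fin 3) K) : Matrix (Fin 3) (Fin 3) K) - 1)).restrictScalars 𝒪[K]) ≤ scaleLattice (ϖ ^ (2 * k + 1 + 1)) w.1 ∧ w.1.map ((Matrix.toLin' ((((γ : GL (Fin 3) K) : Matrix (Fin 3) (Fin 3) K) - 1) ^ 2)).restrictScalars 𝒪[K]) ≤ scaleLattice (ϖ ^ (2 * (2 * k + 1) + 1)) w.1 := by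
    intro κ hκ w hw hfw hwr hadj ht
    obtain ⟨h1, h2, h3, h4⟩ := (rootGrandchildLabels_equilateral hσ hvσ hσϖ hϖ hres h2 hnorm hT hγ0 d hd hdσ A hA hA' hdA s hs1 hsv hsσ hγA hN3 hs0 hs2 hs02 κ hκ hw hfw hwr hadj).2
      ((ϖ ^ N)⁻¹ * pairing σ ((StdForm.antidiagonal 3).over K) (((κ : GL (Fin 3) K) : Matrix (Fin 3) (Fin 3) K) *ᵥ Pi.single 0 1) ((((γ : GL (Fin 3) K) : Matrix (Fin 3) (Fin 3) K) - 1) *ᵥ (((κ : GL (Fin 3) K) : Matrix (Fin 3) (Fin 3) K) *ᵥ Pi.single 0 1))) ht (by rw [sub_self, map_zero]; exact zero_lt_one)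
    have e1 : N - 2 = 2 * k + 1 := by omega
    have e2 : N - 1 = 2 * k + 1 + 1 := by omega
    have e3 : 2 * N - 3 = 2 * (2 * k + 1) + 1 := by omega
    rw [e1] at h1 h4; rw [e2] at h2; rw [e3] at h3
    have hd : dep w = 2 * k + 1 := hdepeq w hfw (2 * k + 1) (by omega) h1 h2
    refine ⟨hd, ?_, h4, h1, h2, h3⟩
    rw [hrk w, hd, if_pos h3]
  -- frames of root grandchildren
  have hframe : ∀ w ∈ GC ⟨stdLattice K 3, 0, isSelfDualLattice_stdLattice_three_of_v hϖ⟩, ∃ κ : unitaryGroupOfForm σ ((StdForm.antidiagonal 3).over K), κ ∈ unitaryInt σ ((StdForm.antidiagonal 3).over K) ∧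
      IsSelfDualLattice σ ϖ ((StdForm.antidiagonal 3).over K) w.1 ∧ latticeGraphIso σ ϖ ((StdForm.antidiagonal 3).over K) γ w = w ∧ w ≠ ⟨stdLattice K 3, 0, isSelfDualLattice_stdLattice_three_of_v hϖ⟩ ∧ (latticeGraph σ ϖ ((StdForm.antidiagonal 3).over K)).Adj (latticeGraphIso σ ϖ ((StdForm.antidiagonal 3).over K) κ ⟨latt (Matrix.diagonal ![(1 : K), 1, ϖ]), 2, isVertexLattice_two_N₁_of_neg hσϖ hϖ⟩) w := by
    intro w hw
    obtain ⟨c, ⟨hrc, -, -⟩, hcw, hdw, hwF⟩ := (hGC _ w).1 hw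
    obtain ⟨κ, hκ, hcκ⟩ := (mem_neighborSet_latticeGraphIso_root_iff hσ hvσ hσϖ hϖ h2 1 c).1
      (by rw [latticeGraphIso_one_apply]; exact (SimpleGraph.mem_neighborSet _ _ _).2 hrc)
    rw [one_mul] at hcκ
    have hcS : ¬ IsSelfDualLattice σ ϖ ((StdForm.antidiagonal 3).over K) c.1 := (isSelfDualLattice_iff_not_isSelfDualLattice_of_adj_of_v hvσ hϖ hrc).1 hrS
    have hwS : IsSelfDualLattice σ ϖ ((StdForm.antidiagonal 3).over K) w.1 := by
      by_contra h; exact hcS ((isSelfDualLattice_iff_not_isSelfDualLattice_of_adj_of_v hvσ hϖ hcw).2 h)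
    have hwr : w ≠ ⟨stdLattice K 3, 0, isSelfDualLattice_stdLattice_three_of_v hϖ⟩ := by
      intro h; rw [h, SimpleGraph.dist_self] at hdw; omega
    exact ⟨κ, hκ, hwS, hwF, hwr, hcκ ▸ hcw⟩
  -- the class rescaling step
  have hCLSmove : ∀ w : {M : Submodule 𝒪[K] (Fin 3 → K) // IsVertex σ ϖ ((StdForm.antidiagonal 3).over K) M}, ∀ t t' : K, (∃ z : K, Valued.v z = 1 ∧ Valued.v (t - t' * z ^ 2) < 1) →
      (∃ y ∈ w.1, ∃ a : K, Valued.v a = 1 ∧ Valued.v ((ϖ ^ (2 * k + 1))⁻¹ * pairing σ ((StdForm.antidiagonal 3).over K) y ((((γ : GL (Fin 3) K) : Matrix (Fin 3) (Fin 3) K) - 1) *ᵥ y) - (t) * a ^ 2) < 1) → (∃ y ∈ w.1, ∃ a : K, Valued.v a = 1 ∧ Valued.v ((ϖ ^ (2 * k + 1))⁻¹ * pairing σ ((StdForm.antidiagonal 3).over K) y ((((γ : GL (Fin 3) K) : Matrix (Fin 3) (Fin 3) K) - 1) *ᵥ y) - (t') * a ^ 2) < 1) := by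
    intro w t t' ⟨z, hz, hzt⟩ ⟨y, hy, a, ha, hlt⟩
    refine ⟨y, hy, z * a, by rw [map_mul, hz, ha, one_mul], ?_⟩
    have key : ∀ X : K, X - t' * (z * a) ^ 2 = (X - t * a ^ 2) + (t - t' * z ^ 2) * a ^ 2 := fun X => by ring
    rw [key]
    refine lt_of_le_of_lt (Valuation.map_add _ _ _) (max_lt hlt ?_)
    rw [map_mul, map_pow, ha, one_pow, mul_one]; exact hzt
  -- a unit close to a unit times a unit square is a unit
  have hunit_of_close : ∀ (x t a : K), Valued.v x ≤ 1 → Valued.v t = 1 → Valued.v a = 1 → Valued.v (x - t * a ^ 2) < 1 → Valued.v x = 1 := by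
    intro x t a hx ht ha hlt
    by_contra hne
    have hx1 : Valued.v x < 1 := lt_of_le_of_ne hx hne
    have hta : Valued.v (t * a ^ 2) = 1 := by rw [map_mul, map_pow, ht, ha, one_pow, mul_one]
    have : Valued.v (x - t * a ^ 2) = 1 := by
      rw [← hta]
      rw [← hta] at hx1
      rw [Valuation.map_sub_swap]
      exact Valuation.map_sub_eq_of_lt_left _ hx1
    exact (lt_irrefl _) (this ▸ hlt)
  -- nilpotency at depth `2k+1` (ROW-N) and the eigen-data bounds
  have hμ₁ : Valued.v (s 0 - 1) ≤ Valued.v ϖ ^ (2 * k + 1 + 1) := by rw [hs0]; exact pow_le_pow_right_of_le_one' hϖ1 (by omega)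
  have hμ₂ : Valued.v (s 2 - 1) ≤ Valued.v ϖ ^ (2 * k + 1 + 1) := by rw [hs2]; exact pow_le_pow_right_of_le_one' hϖ1 (by omega)
  have hchar := charpoly_of_eigenframe (γ := γ) A s hs1 hγA
  have hGCr : GC ⟨stdLattice K 3, 0, isSelfDualLattice_stdLattice_three_of_v hϖ⟩ = {w | ∃ c, ((latticeGraph σ ϖ ((StdForm.antidiagonal 3).over K)).Adj ⟨stdLattice K 3, 0, isSelfDualLattice_stdLattice_three_of_v hϖ⟩ c ∧ (latticeGraph σ ϖ ((StdForm.antidiagonal 3).over K)).dist ⟨stdLattice K 3, 0, isSelfDualLattice_stdLattice_three_of_v hϖ⟩ c = (latticeGraph σ ϖ ((StdForm.antidiagonal 3).over K)).dist ⟨stdLattice K 3, 0, isSelfDualLattice_stdLattice_three_of_v hϖ⟩ ⟨stdLattice K 3, 0, isSelfDualLattice_stdLattice_three_of_v hϖ⟩ + 1 ∧ latticeGraphIso σ ϖ ((StdForm.antidiagonal 3).over K) γ c = c) ∧ ((latticeGraph σ ϖ ((StdForm.antidiagonal 3).over K)).Adj c w ∧ (latticeGraph σ ϖ ((StdForm.antidiagonal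 3).over K)).dist ⟨stdLattice K 3, 0, isSelfDualLattice_stdLattice_three_of_v hϖ⟩ w = (latticeGraph σ ϖ ((StdForm.antidiagonal 3).over K)).dist ⟨stdLattice K 3, 0, isSelfDualLattice_stdLattice_three_of_v hϖ⟩ c + 1 ∧ latticeGraphIso σ ϖ ((StdForm.antidiagonal 3).over K) γ w = w)} := Set.ext (fun w => hGC _ w)
  have hc₁ε : Valued.v (c₁ * ε) = 1 := by rw [map_mul, hc₁, hεv, one_mul]
  refine ⟨hrdep, ?_, ?_, ?_, ?_⟩
  · -- the label disjunction
    intro w hw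
    obtain ⟨κ, hκ, hwS, hwF, hwr, hadj⟩ := hframe w hw
    rcases (hVALint κ hκ).lt_or_eq with ht | ht
    · exact Or.inl (hE κ hκ w hwS hwF hwr hadj ht)
    · obtain ⟨hd, hr, -, -⟩ := hPP κ hκ w hwS hwF hwr hadj ht
      refine Or.inr ⟨hd, hr, ?_⟩
      rw [hcl w]
      split_ifs
      · exact Or.inl rfl
      · exact Or.inr rfl
  · -- the `E`-count
    have h := ncard_rootGrandchildren_sep_eq_mul_ncard_keyed hσ hvσ hσϖ hϖ hres h2 hT hγ0 hdeep (fun κ => Valued.v ((ϖ ^ N)⁻¹ * pairing σ ((StdForm.antidiagonal 3).over K) (((κ : GL (Fin 3) K) : Matrix (Fin 3) (Fin 3) K) *ᵥ Pi.single 0 1) ((((γ : GL (Fin 3) K) : Matrix (Fin 3) (Fin 3) K) - 1) *ᵥ (((κ : GL (Fin 3) K) : Matrix (Fin 3) (Fin 3) K) *ᵥ Pi.single 0 1))) < 1) (fun w => dep w = 2 * k + 2) ?_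
    · rw [hGCr, hq, ← hνE]; exact h
    · intro κ hκ w hwS hwF hwr hadj
      constructor
      · intro hd
        rcases (hVALint κ hκ).lt_or_eq with ht | ht
        · exact ht
        · have := (hPP κ hκ w hwS hwF hwr hadj ht).1; omega
      · intro ht; exact (hE κ hκ w hwS hwF hwr hadj ht).1
  · -- the `P⁺`-count (class `c₁` at the grandchild ⟺ line class `−c₁`)
    have h := ncard_rootGrandchildren_sep_eq_mul_ncard_keyed hσ hvσ hσϖ hϖ hres h2 hT hγ0 hdeep
      (fun κ => ∃ a : K, Valued.v a = 1 ∧ Valued.v (((ϖ ^ N)⁻¹ * pairing σ ((StdForm.antidiagonal 3).over K) (((κ : GL (Fin 3) K) : Matrix (Fin 3) (Fin 3) K) *ᵥ Pi.single 0 1) ((((γ : GL (Fin 3) K) : Matrix (Fin 3) (Fin 3) K) - 1) *ᵥ (((κ : GL (Fin 3) K) : Matrix (Fin 3) (Fin 3) K) *ᵥ Pi.single 0 1))) - (-c₁) * a ^ 2) < 1) (fun w => dep w = 2 * k + 1 ∧ cl w = 1) ?_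
    · rw [hGCr, hq, ← hνP]; exact h
    · intro κ hκ w hwS hwF hwr hadj
      constructor
      · rintro ⟨hd, hcw⟩
        rcases (hVALint κ hκ).lt_or_eq with ht | ht
        · have := (hE κ hκ w hwS hwF hwr hadj ht).1; omega
        obtain ⟨-, -, hcls, hl1, hl2, hr3⟩ := hPP κ hκ w hwS hwF hwr hadj ht
        rw [hcl w, hd] at hcw
        by_cases hcw1 : ∃ y ∈ w.1, ∃ a : K, Valued.v a = 1 ∧ Valued.v ((ϖ ^ (2 * k + 1))⁻¹ * pairing σ ((StdForm.antidiagonal 3).over K) y ((((γ : GL (Fin 3) K) : Matrix (Fin 3) (Fin 3) K) - 1) *ᵥ y) - (c₁) * a ^ 2) < 1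
        · have hnil := map_sub_one_pow_three_le_scaleLattice_of_charpoly_antidiagonal hϖ hγ0 hchar hμ₁ hμ₂ w hl1
          obtain ⟨z, hz, hzlt⟩ := exists_unit_sub_mul_sq_lt_one_of_fixed_selfDual_rankOne hσ hvσ hσϖ hϖ hres h2 hγ0 hwS hwF (d := 2 * k + 1) (by omega) hl1 hl2 hr3 hnil
            c₁ (-((ϖ ^ N)⁻¹ * pairing σ ((StdForm.antidiagonal 3).over K) (((κ : GL (Fin 3) K) : Matrix (Fin 3) (Fin 3) K) *ᵥ Pi.single 0 1) ((((γ : GL (Fin 3) K) : Matrix (Fin 3) (Fin 3) K) - 1) *ᵥ (((κ : GL (Fin 3) K) : Matrix (Fin 3) (Fin 3) K) *ᵥ Pi.single 0 1)))) ε hc₁ (by rw [Valuation.map_neg]; exact ht) hεv hε hcw1 hcls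
          refine ⟨z, hz, ?_⟩
          rw [← Valuation.map_neg, neg_sub, sub_neg_eq_add, show c₁ * z ^ 2 + ((ϖ ^ N)⁻¹ * pairing σ ((StdForm.antidiagonal 3).over K) (((κ : GL (Fin 3) K) : Matrix (Fin 3) (Fin 3) K) *ᵥ Pi.single 0 1) ((((γ : GL (Fin 3) K) : Matrix (Fin 3) (Fin 3) K) - 1) *ᵥ (((κ : GL (Fin 3) K) : Matrix (Fin 3) (Fin 3) K) *ᵥ Pi.single 0 1))) = ((ϖ ^ N)⁻¹ * pairing σ ((StdForm.antidiagonal 3).over K) (((κ : GL (Fin 3) K) : Matrix (Fin 3) (Fin 3) K) *ᵥ Pi.single 0 1) ((((γ : GL (Fin 3) K) : Matrix (Fin 3) (Fin 3) K) - 1) *ᵥ (((κ : GL (Fin 3) K) : Matrix (Fin 3) (Fin 3) K) *ᵥ Pi.single 0 1))) - (-c₁) * z ^ 2 by ring] at hzlt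
          exact hzlt
        · rw [if_neg hcw1] at hcw; norm_num at hcw
      · rintro ⟨a, ha, hlt⟩
        have ht : Valued.v ((ϖ ^ N)⁻¹ * pairing σ ((StdForm.antidiagonal 3).over K) (((κ : GL (Fin 3) K) : Matrix (Fin 3) (Fin 3) K) *ᵥ Pi.single 0 1) ((((γ : GL (Fin 3) K) : Matrix (Fin 3) (Fin 3) K) - 1) *ᵥ (((κ : GL (Fin 3) K) : Matrix (Fin 3) (Fin 3) K) *ᵥ Pi.single 0 1))) = 1 := hunit_of_close _ (-c₁) a (hVALint κ hκ) (by rw [Valuation.map_neg]; exact hc₁) ha hlt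
        obtain ⟨hd, -, hcls, -, -, -⟩ := hPP κ hκ w hwS hwF hwr hadj ht
        refine ⟨hd, ?_⟩
        have hcls' : ∃ y ∈ w.1, ∃ a : K, Valued.v a = 1 ∧ Valued.v ((ϖ ^ (2 * k + 1))⁻¹ * pairing σ ((StdForm.antidiagonal 3).over K) y ((((γ : GL (Fin 3) K) : Matrix (Fin 3) (Fin 3) K) - 1) *ᵥ y) - (c₁) * a ^ 2) < 1 :=
          hCLSmove w (-((ϖ ^ N)⁻¹ * pairing σ ((StdForm.antidiagonal 3).over K) (((κ : GL (Fin 3) K) : Matrix (Fin 3) (Fin 3) K) *ᵥ Pi.single 0 1) ((((γ : GL (Fin 3) K) : Matrix (Fin 3) (Fin 3) K) - 1) *ᵥ (((κ : GL (Fin 3) K) : Matrix (Fin 3) (Fin 3) K) *ᵥ Pi.single 0 1)))) c₁ ⟨a, ha, by rw [show -((ϖ ^ N)⁻¹ * pairing σ ((StdForm.antidiagonal 3).over K) (((κ : GL (Fin 3) K) : Matrix (Fin 3) (Fin 3) K) *ᵥ Pi.single 0 1) ((((γ : GL (Fin 3) K) : Matrix (Fin 3) (Fin 3) K) - 1) *ᵥ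 (((κ : GL (Fin 3) K) : Matrix (Fin 3) (Fin 3) K) *ᵥ Pi.single 0 1))) - c₁ * a ^ 2 = -(((ϖ ^ N)⁻¹ * pairing σ ((StdForm.antidiagonal 3).over K) (((κ : GL (Fin 3) K) : Matrix (Fin 3) (Fin 3) K) *ᵥ Pi.single 0 1) ((((γ : GL (Fin 3) K) : Matrix (Fin 3) (Fin 3) K) - 1) *ᵥ (((κ : GL (Fin 3) K) : Matrix (Fin 3) (Fin 3) K) *ᵥ Pi.single 0 1))) - (-c₁) * a ^ 2) by ring, Valuation.map_neg]; exact hlt⟩ hcls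
        rw [hcl w, hd, if_pos hcls']
  · -- the `P⁻`-count (class `c₁·ε` at the grandchild ⟺ not class `c₁` ⟺ line class `−c₁ε`)
    have h := ncard_rootGrandchildren_sep_eq_mul_ncard_keyed hσ hvσ hσϖ hϖ hres h2 hT hγ0 hdeep
      (fun κ => ∃ a : K, Valued.v a = 1 ∧ Valued.v (((ϖ ^ N)⁻¹ * pairing σ ((StdForm.antidiagonal 3).over K) (((κ : GL (Fin 3) K) : Matrix (Fin 3) (Fin 3) K) *ᵥ Pi.single 0 1) ((((γ : GL (Fin 3) K) : Matrix (Fin 3) (Fin 3) K) - 1) *ᵥ (((κ : GL (Fin 3) K) : Matrix (Fin 3) (Fin 3) K) *ᵥ Pi.single 0 1))) - (-(c₁ * ε)) * a ^ 2) < 1) (fun w => dep w = 2 * k + 1 ∧ cl w = -1) ?_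
    · rw [hGCr, hq, ← hνM]; exact h
    · intro κ hκ w hwS hwF hwr hadj
      constructor
      · rintro ⟨hd, hcw⟩
        rcases (hVALint κ hκ).lt_or_eq with ht | ht
        · have := (hE κ hκ w hwS hwF hwr hadj ht).1; omega
        obtain ⟨-, -, hcls, hl1, hl2, hr3⟩ := hPP κ hκ w hwS hwF hwr hadj ht
        rw [hcl w, hd] at hcw
        by_cases hcw1 : ∃ y ∈ w.1, ∃ a : K, Valued.v a = 1 ∧ Valued.v ((ϖ ^ (2 * k + 1))⁻¹ * pairing σ ((StdForm.antidiagonal 3).over K) y ((((γ : GL (Fin 3) K) : Matrix (Fin 3) (Fin 3) K) - 1) *ᵥ y) - (c₁) * a ^ 2) < 1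
        · rw [if_pos hcw1] at hcw; norm_num at hcw
        · have hnil := map_sub_one_pow_three_le_scaleLattice_of_charpoly_antidiagonal hϖ hγ0 hchar hμ₁ hμ₂ w hl1
          -- not class `c₁` ⇒ class `c₁ε` (ROW-1C), then transitivity with `−VAL`
          have hx := class_xor_class_mul_of_fixed_selfDual_rankOne hσ hvσ hσϖ hϖ hres h2 hγ0 hwS hwF (d := 2 * k + 1) (by omega) hl1 hl2 hr3 hnil c₁ ε hc₁ hεv hε
          have hcε : ∃ y ∈ w.1, ∃ a : K, Valued.v a = 1 ∧ Valued.v ((ϖ ^ (2 * k + 1))⁻¹ * pairing σ ((StdForm.antidiagonal 3).over K) y ((((γ : GL (Fin 3) K) : Matrix (Fin 3) (Fin 3) K) - 1) *ᵥ y) - (c₁ * ε) * a ^ 2) < 1 := hx.1.resolve_left hcw1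
          obtain ⟨z, hz, hzlt⟩ := exists_unit_sub_mul_sq_lt_one_of_fixed_selfDual_rankOne hσ hvσ hσϖ hϖ hres h2 hγ0 hwS hwF (d := 2 * k + 1) (by omega) hl1 hl2 hr3 hnil
            (c₁ * ε) (-((ϖ ^ N)⁻¹ * pairing σ ((StdForm.antidiagonal 3).over K) (((κ : GL (Fin 3) K) : Matrix (Fin 3) (Fin 3) K) *ᵥ Pi.single 0 1) ((((γ : GL (Fin 3) K) : Matrix (Fin 3) (Fin 3) K) - 1) *ᵥ (((κ : GL (Fin 3) K) : Matrix (Fin 3) (Fin 3) K) *ᵥ Pi.single 0 1)))) ε hc₁ε (by rw [Valuation.map_neg]; exact ht) hεv hε hcε hcls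
          refine ⟨z, hz, ?_⟩
          rw [← Valuation.map_neg, neg_sub, sub_neg_eq_add, show c₁ * ε * z ^ 2 + ((ϖ ^ N)⁻¹ * pairing σ ((StdForm.antidiagonal 3).over K) (((κ : GL (Fin 3) K) : Matrix (Fin 3) (Fin 3) K) *ᵥ Pi.single 0 1) ((((γ : GL (Fin 3) K) : Matrix (Fin 3) (Fin 3) K) - 1) *ᵥ (((κ : GL (Fin 3) K) : Matrix (Fin 3) (Fin 3) K) *ᵥ Pi.single 0 1))) = ((ϖ ^ N)⁻¹ * pairing σ ((StdForm.antidiagonal 3).over K) (((κ : GL (Fin 3) K) : Matrix (Fin 3) (Fin 3) K) *ᵥ Pi.single 0 1) ((((γ : GL (Fin 3) K) : Matrix (Fin 3) (Fin 3) K) - 1) *ᵥ (((κ : GL (Fin 3) K) : Matrix (Fin 3) (Fin 3) K) *ᵥ Pi.single 0 1))) - (-(c₁ * ε)) * z ^ 2 by ring] at hzlt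
          exact hzlt
      · rintro ⟨a, ha, hlt⟩
        have ht : Valued.v ((ϖ ^ N)⁻¹ * pairing σ ((StdForm.antidiagonal 3).over K) (((κ : GL (Fin 3) K) : Matrix (Fin 3) (Fin 3) K) *ᵥ Pi.single 0 1) ((((γ : GL (Fin 3) K) : Matrix (Fin 3) (Fin 3) K) - 1) *ᵥ (((κ : GL (Fin 3) K) : Matrix (Fin 3) (Fin 3) K) *ᵥ Pi.single 0 1))) = 1 := hunit_of_close _ (-(c₁ * ε)) a (hVALint κ hκ) (by rw [Valuation.map_neg]; exact hc₁ε) ha hlt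
        obtain ⟨hd, -, hcls, hl1, hl2, hr3⟩ := hPP κ hκ w hwS hwF hwr hadj ht
        refine ⟨hd, ?_⟩
        have hcε : ∃ y ∈ w.1, ∃ a : K, Valued.v a = 1 ∧ Valued.v ((ϖ ^ (2 * k + 1))⁻¹ * pairing σ ((StdForm.antidiagonal 3).over K) y ((((γ : GL (Fin 3) K) : Matrix (Fin 3) (Fin 3) K) - 1) *ᵥ y) - (c₁ * ε) * a ^ 2) < 1 :=
          hCLSmove w (-((ϖ ^ N)⁻¹ * pairing σ ((StdForm.antidiagonal 3).over K) (((κ : GL (Fin 3) K) : Matrix (Fin 3) (Fin 3) K) *ᵥ Pi.single 0 1) ((((γ : GL (Fin 3) K) : Matrix (Fin 3) (Fin 3) K) - 1) *ᵥ (((κ : GL (Fin 3) K) : Matrix (Fin 3) (Fin 3) K) *ᵥ Pi.single 0 1)))) (c₁ * ε) ⟨a, ha, by rw [show -((ϖ ^ N)⁻¹ * pairing σ ((StdForm.antidiagonal 3).over K) (((κ : GL (Fin 3) K) : Matrix (Fin 3) (Fin 3) K) *ᵥ Pi.single 0 1) ((((γ : GL (Fin 3) K) : Matrix (Fin 3)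 (Fin 3) K) - 1) *ᵥ (((κ : GL (Fin 3) K) : Matrix (Fin 3) (Fin 3) K) *ᵥ Pi.single 0 1))) - c₁ * ε * a ^ 2 = -(((ϖ ^ N)⁻¹ * pairing σ ((StdForm.antidiagonal 3).over K) (((κ : GL (Fin 3) K) : Matrix (Fin 3) (Fin 3) K) *ᵥ Pi.single 0 1) ((((γ : GL (Fin 3) K) : Matrix (Fin 3) (Fin 3) K) - 1) *ᵥ (((κ : GL (Fin 3) K) : Matrix (Fin 3) (Fin 3) K) *ᵥ Pi.single 0 1))) - (-(c₁ * ε)) * a ^ 2) by ring, Valuation.map_neg]; exact hlt⟩ hcls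
        have hnil := map_sub_one_pow_three_le_scaleLattice_of_charpoly_antidiagonal hϖ hγ0 hchar hμ₁ hμ₂ w hl1
        have hx := class_xor_class_mul_of_fixed_selfDual_rankOne hσ hvσ hσϖ hϖ hres h2 hγ0 hwS hwF (d := 2 * k + 1) (by omega) hl1 hl2 hr3 hnil c₁ ε hc₁ hεv hε
        have hnot : ¬ (∃ y ∈ w.1, ∃ a : K, Valued.v a = 1 ∧ Valued.v ((ϖ ^ (2 * k + 1))⁻¹ * pairing σ ((StdForm.antidiagonal 3).over K) y ((((γ : GL (Fin 3) K) : Matrix (Fin 3) (Fin 3) K) - 1) *ᵥ y) - (c₁) * a ^ 2) < 1) := fun hc => hx.2 ⟨hc, hcε⟩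
        rw [hcl w, hd, if_neg hnot]

/-- iso-L4 (assembly pen): at a REGION vertex `v` (fixed, self-dual, `LEV[v](ϖ^d₀)`), every fixed grandchild OUTSIDE the region has the `E`-label `(2mA+2, 2)` or the
`P`-label `(2mA+1, 1, ±)` (`d₀ = 2mA + 3`) — ★ S2 keyed by the child frame, value integral by the region token. [cite: Kottwitz1986, §3] [cite: Rogawski1990, §4.9 pp. 54–56] -/
theorem regionData_of_rows (hσ : ∀ x, σ (σ x) = x) (hvσ : ∀ a, Valued.v (σ a) = Valued.v a) (hσϖ : σ ϖ = -ϖ)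
    (hϖ : Valued.v ϖ = WithZero.exp (-1 : ℤ)) (hres : ∀ x : K, Valued.v x ≤ 1 → Valued.v (σ x - x) < 1) (h2 : Valued.v (2 : K) = 1) [Finite 𝓀[K]]
    (hT : (latticeGraph σ ϖ ((StdForm.antidiagonal 3).over K)).IsTree)
    {γ : unitaryGroupOfForm σ ((StdForm.antidiagonal 3).over K)} (hγ0 : γ ∈ unitaryInt σ ((StdForm.antidiagonal 3).over K))
    (hnorm : ∀ u : K, σ u = u → Valued.v (u - 1) < 1 → ∃ z : K, z * σ z = u ∧ Valued.v (z - 1) ≤ Valued.v (u - 1))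
    (d : Fin 3 → K) (hd : ∀ i, Valued.v (d i) = 1) (hdσ : ∀ i, σ (d i) = d i)
    (A : GL (Fin 3) K) (hA : IsIntMatrix (A : Matrix (Fin 3) (Fin 3) K)) (hA' : IsIntMatrix ((A⁻¹ : GL (Fin 3) K) : Matrix (Fin 3) (Fin 3) K))
    (hdA : Matrix.diagonal d = (-(Matrix.diagonal d).det) • formCongr σ A ((StdForm.antidiagonal 3).over K))
    (s : Fin 3 → K) (hs1 : s 1 = 1) (hsv : ∀ i, Valued.v (s i) = 1) (hsσ : ∀ i, s i * σ (s i) = 1)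
    (hγA : ((γ : GL (Fin 3) K) : Matrix (Fin 3) (Fin 3) K) = (A : Matrix (Fin 3) (Fin 3) K) * Matrix.diagonal s * ((A⁻¹ : GL (Fin 3) K) : Matrix (Fin 3) (Fin 3) K))
    (i₀ : Fin 3) {d₀ : ℕ} (hd3 : 3 ≤ d₀) (he : ∀ i, Valued.v (s i - 1) ≤ Valued.v ϖ ^ d₀)
    (hiso : ∀ j, j ≠ i₀ → Valued.v (s i₀ - s j) = Valued.v ϖ ^ d₀) (hclose : ∀ j k, j ≠ i₀ → k ≠ i₀ → Valued.v (s j - s k) ≤ Valued.v ϖ ^ (d₀ + 2))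
    (c₁ ε : K) (_hc₁ : Valued.v c₁ = 1) (_hεv : Valued.v ε = 1) (_hε : ∀ z : K, Valued.v z ≤ 1 → Valued.v (z ^ 2 - ε) = 1)
    (B : ℕ) (dep rk : {M : Submodule 𝒪[K] (Fin 3 → K) // IsVertex σ ϖ ((StdForm.antidiagonal 3).over K) M} → ℕ) (cl : {M : Submodule 𝒪[K] (Fin 3 → K) // IsVertex σ ϖ ((StdForm.antidiagonal 3).over K) M} → ℤ)
    (hdep : ∀ w : {M : Submodule 𝒪[K] (Fin 3 → K) // IsVertex σ ϖ ((StdForm.antidiagonal 3).over K) M}, latticeGraphIso σ ϖ ((StdForm.antidiagonal 3).over K) γ w = w → ∀ e, e ≤ dep w ↔ e ≤ B ∧ w.1.map ((Matrix.toLin' (((γ : GL (Fin 3) K) : Matrix (Fin 3) (Fin 3) K) - 1)).restrictScalars 𝒪[K]) ≤ scaleLattice (ϖ ^ e) w.1)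
    (hrk : ∀ w : {M : Submodule 𝒪[K] (Fin 3 → K) // IsVertex σ ϖ ((StdForm.antidiagonal 3).over K) M}, rk w = if w.1.map ((Matrix.toLin' ((((γ : GL (Fin 3) K) : Matrix (Fin 3) (Fin 3) K) - 1) ^ 2)).restrictScalars 𝒪[K]) ≤ scaleLattice (ϖ ^ (2 * dep w + 1)) w.1 then 1 else 2)
    (hcl : ∀ w : {M : Submodule 𝒪[K] (Fin 3 → K) // IsVertex σ ϖ ((StdForm.antidiagonal 3).over K) M}, cl w = if (∃ y ∈ w.1, ∃ a : K, Valued.v a = 1 ∧ Valued.v ((ϖ ^ (dep w))⁻¹ * pairing σ ((StdForm.antidiagonal 3).over K) y ((((γ : GL (Fin 3) K) : Matrix (Fin 3) (Fin 3) K) - 1) *ᵥ y) - (c₁) * a ^ 2) < 1) then (1 : ℤ) else -1)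
    (hBd : d₀ ≤ B)
    (GC : {M : Submodule 𝒪[K] (Fin 3 → K) // IsVertex σ ϖ ((StdForm.antidiagonal 3).over K) M} → Set {M : Submodule 𝒪[K] (Fin 3 → K) // IsVertex σ ϖ ((StdForm.antidiagonal 3).over K) M}) (hGC : ∀ v w, w ∈ GC v ↔ ∃ c, ((latticeGraph σ ϖ ((StdForm.antidiagonal 3).over K)).Adj v c ∧ (latticeGraph σ ϖ ((StdForm.antidiagonal 3).over K)).dist ⟨stdLattice K 3, 0, isSelfDualLattice_stdLattice_three_of_v hϖ⟩ c = (latticeGraph σ ϖ ((StdForm.antidiagonal 3).over K)).dist ⟨stdLattice K 3, 0, isSelfDualLattice_stdLattice_three_of_v hϖ⟩ v + 1 ∧ c ∈ {v | latticeGraphIso σ ϖ ((StdForm.antidiagonal 3).over K) γ v = v}) ∧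
      ((latticeGraph σ ϖ ((StdForm.antidiagonal 3).over K)).Adj c w ∧ (latticeGraph σ ϖ ((StdForm.antidiagonal 3).over K)).dist ⟨stdLattice K 3, 0, isSelfDualLattice_stdLattice_three_of_v hϖ⟩ w = (latticeGraph σ ϖ ((StdForm.antidiagonal 3).over K)).dist ⟨stdLattice K 3, 0, isSelfDualLattice_stdLattice_three_of_v hϖ⟩ c + 1 ∧ w ∈ {v | latticeGraphIso σ ϖ ((StdForm.antidiagonal 3).over K) γ v = v}))
    (mA : ℕ) (hmA : d₀ = 2 * mA + 3)
    {v : {M : Submodule 𝒪[K] (Fin 3 → K) // IsVertex σ ϖ ((StdForm.antidiagonal 3).over K) M}} (hfix : latticeGraphIso σ ϖ ((StdForm.antidiagonal 3).over K) γ v = v) (hv : IsSelfDualLattice σ ϖ ((StdForm.antidiagonal 3).over K) v.1) (hvR : v.1.map ((Matrix.toLin' (((γ : GL (Fin 3) K) : Matrix (Fin 3) (Fin 3) K) - 1)).restrictScalars 𝒪[K]) ≤ scaleLattice (ϖ ^ d₀) v.1) :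
    ∀ w ∈ GC v, w ∉ {v : {M : Submodule 𝒪[K] (Fin 3 → K) // IsVertex σ ϖ ((StdForm.antidiagonal 3).over K) M} | latticeGraphIso σ ϖ ((StdForm.antidiagonal 3).over K) γ v = v ∧ IsSelfDualLattice σ ϖ ((StdForm.antidiagonal 3).over K) v.1 ∧ v.1.map ((Matrix.toLin' (((γ : GL (Fin 3) K) : Matrix (Fin 3) (Fin 3) K) - 1)).restrictScalars 𝒪[K]) ≤ scaleLattice (ϖ ^ d₀) v.1} →
      (dep w = 2 * mA + 2 ∧ rk w = 2) ∨ (dep w = 2 * mA + 1 ∧ rk w = 1 ∧ (cl w = 1 ∨ cl w = -1)) := by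
  have hϖ0 : ϖ ≠ 0 := fun h0 => by rw [h0, map_zero] at hϖ; exact WithZero.coe_ne_zero hϖ.symm
  have hϖ1 : Valued.v ϖ ≤ 1 := by rw [hϖ, ← WithZero.exp_zero]; exact WithZero.exp_le_exp.2 (by norm_num)
  -- `v = u·r₀`
  obtain ⟨u, hu⟩ := exists_latticeGraphIso_root_eq_of_v_two hσ hvσ hϖ h2 v hv (isSelfDualLattice_stdLattice_three_of_v hϖ)
  have hvu : v = latticeGraphIso σ ϖ ((StdForm.antidiagonal 3).over K) u ⟨stdLattice K 3, 0, isSelfDualLattice_stdLattice_three_of_v hϖ⟩ := hu.symm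
  -- the conjugate `u⁻¹γu − 1` has level `ϖ^d₀`
  have hY : ∀ i j, Valued.v (((((u⁻¹ * γ * u : unitaryGroupOfForm σ ((StdForm.antidiagonal 3).over K)) : GL (Fin 3) K) : Matrix (Fin 3) (Fin 3) K) - 1) i j) ≤ Valued.v ϖ ^ d₀ := by
    have h := (forall_v_conj_sub_one_le_iff_map_sub_one_le_scaleLattice γ u (pow_ne_zero d₀ hϖ0)).1 (by rw [← hu] at hvR; exact hvR)
    intro i j; rw [← map_pow]; exact h i j
  have hdepeq : ∀ w : {M : Submodule 𝒪[K] (Fin 3 → K) // IsVertex σ ϖ ((StdForm.antidiagonal 3).over K) M}, latticeGraphIso σ ϖ ((StdForm.antidiagonal 3).over K) γ w = w → ∀ e, e < B → w.1.map ((Matrix.toLin' (((γ : GL (Fin 3) K) : Matrix (Fin 3) (Fin 3) K) - 1)).restrictScalars 𝒪[K]) ≤ scaleLattice (ϖ ^ e) w.1 → ¬ w.1.map ((Matrix.toLin' (((γ : GL (Fin 3) K) : Matrix (Fin 3) (Fin 3) K) - 1)).restrictScalars 𝒪[K]) ≤ scaleLattice (ϖ ^ (e + 1)) w.1 → dep w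 = e := by
    intro w hw e he h1 h2
    have a := (hdep w hw e).2 ⟨he.le, h1⟩
    have b : ¬ (e + 1 ≤ dep w) := fun h => h2 ((hdep w hw (e + 1)).1 h).2
    omega
  intro w hw hwR'
  obtain ⟨c, ⟨hvc, hdc, -⟩, hcw, hdw, hwF⟩ := (hGC _ w).1 hw
  obtain ⟨κ, hκ, hcκ⟩ := (mem_neighborSet_latticeGraphIso_root_iff hσ hvσ hσϖ hϖ h2 u c).1
    (by rw [← hvu]; exact (SimpleGraph.mem_neighborSet _ _ _).2 hvc)
  have hcS : ¬ IsSelfDualLattice σ ϖ ((StdForm.antidiagonal 3).over K) c.1 := (isSelfDualLattice_iff_not_isSelfDualLattice_of_adj_of_v hvσ hϖ hvc).1 hv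
  have hwS : IsSelfDualLattice σ ϖ ((StdForm.antidiagonal 3).over K) w.1 := by
    by_contra h; exact hcS ((isSelfDualLattice_iff_not_isSelfDualLattice_of_adj_of_v hvσ hϖ hcw).2 h)
  have hwv : w ≠ v := by
    intro h; rw [h] at hdw; omega
  have hadj : (latticeGraph σ ϖ ((StdForm.antidiagonal 3).over K)).Adj (latticeGraphIso σ ϖ ((StdForm.antidiagonal 3).over K) (u * κ) ⟨latt (Matrix.diagonal ![(1 : K), 1, ϖ]), 2, isVertexLattice_two_N₁_of_neg hσϖ hϖ⟩) w := hcκ ▸ hcw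
  have hwR : ¬ w.1.map ((Matrix.toLin' (((γ : GL (Fin 3) K) : Matrix (Fin 3) (Fin 3) K) - 1)).restrictScalars 𝒪[K]) ≤ scaleLattice (ϖ ^ d₀) w.1 := fun h => hwR' ⟨hwF, hwS, h⟩
  -- integrality of the line value
  have hVAL : Valued.v ((ϖ ^ d₀)⁻¹ * pairing σ ((StdForm.antidiagonal 3).over K) (((κ : GL (Fin 3) K) : Matrix (Fin 3) (Fin 3) K) *ᵥ Pi.single 0 1) (((((u⁻¹ * γ * u : unitaryGroupOfForm σ ((StdForm.antidiagonal 3).over K)) : GL (Fin 3) K) : Matrix (Fin 3) (Fin 3) K) - 1) *ᵥ (((κ : GL (Fin 3) K) : Matrix (Fin 3) (Fin 3) K) *ᵥ Pi.single 0 1))) ≤ 1 := by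
    rw [pairing_coe_mulVec_single_eq_inv_mul_mul_apply κ ((((u⁻¹ * γ * u : unitaryGroupOfForm σ ((StdForm.antidiagonal 3).over K)) : GL (Fin 3) K) : Matrix (Fin 3) (Fin 3) K) - 1)]
    have hcorner := v_mul_mul_apply_le_of_le (mem_unitaryInt_iff.1 hκ).2 hY (mem_unitaryInt_iff.1 hκ).1 (2 : Fin 3) 0
    rw [map_mul, map_inv₀, map_pow]
    calc (Valued.v ϖ ^ d₀)⁻¹ * _ ≤ (Valued.v ϖ ^ d₀)⁻¹ * Valued.v ϖ ^ d₀ := mul_le_mul_right hcorner _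
      _ = 1 := inv_mul_cancel₀ (pow_ne_zero _ (by rw [hϖ]; exact WithZero.coe_ne_zero))
  have hS2 := offRegionGrandchildLabels hσ hvσ hσϖ hϖ hres h2 hT hγ0 hnorm d hd hdσ A hA hA' hdA s hs1 hsv hsσ hγA i₀ hd3 he hiso hclose
    u hvu hv hfix hvR κ hκ hwS hwF hwv hadj hwR
  rcases hVAL.lt_or_eq with ht | ht
  · obtain ⟨h1, h2', h3⟩ := hS2.1 ht
    have hd : dep w = 2 * mA + 2 := hdepeq w hwF (2 * mA + 2) (by omega) (by rw [show 2 * mA + 2 = d₀ - 1 by omega]; exact h1)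
      (by rw [show 2 * mA + 2 + 1 = d₀ by omega]; exact h2')
    refine Or.inl ⟨hd, ?_⟩
    rw [hrk w, hd, show 2 * (2 * mA + 2) + 1 = 2 * d₀ - 1 by omega, if_neg h3]
  · obtain ⟨h1, h2', h3, -⟩ := hS2.2 ((ϖ ^ d₀)⁻¹ * pairing σ ((StdForm.antidiagonal 3).over K) (((κ : GL (Fin 3) K) : Matrix (Fin 3) (Fin 3) K) *ᵥ Pi.single 0 1) (((((u⁻¹ * γ * u : unitaryGroupOfForm σ ((StdForm.antidiagonal 3).over K)) : GL (Fin 3) K) : Matrix (Fin 3) (Fin 3) K) - 1) *ᵥ (((κ : GL (Fin 3) K) : Matrix (Fin 3) (Fin 3) K) *ᵥ Pi.single 0 1))) ht (by rw [sub_self, map_zero]; exact zero_lt_one)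
    have e1 : d₀ - 2 = 2 * mA + 1 := by omega
    have e2 : d₀ - 1 = 2 * mA + 1 + 1 := by omega
    have e3 : 2 * d₀ - 3 = 2 * (2 * mA + 1) + 1 := by omega
    rw [e1] at h1; rw [e2] at h2'; rw [e3] at h3
    have hd : dep w = 2 * mA + 1 := hdepeq w hwF (2 * mA + 1) (by omega) h1 h2'
    refine Or.inr ⟨hd, by rw [hrk w, hd, if_pos h3], ?_⟩
    rw [hcl w]
    split_ifs
    · exact Or.inl rfl
    · exact Or.inr rfl

end Literature.NumberTheory.Rogawski1990.TypeOneRamifiedJunction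

end
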